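import Summits.AtomisticToContinuum.HydrodynamicLimit.Theses.JaynesSqueeze
import Literature.MathematicalPhysics.KineticTheory.HardSphereEulerClassicalUniqueness
import Literature.Analysis.FunctionSpaces.TorusSpaceTime

/-!
# Birth skeleton (BC3) for crux `MeanBlocksInRange`
(stmt-AtomisticToContinuum-13458, route `JaynesSqueeze`, rank 5; sub-problem `HydrodynamicLimit`)

Crux (FIXED, imported by name):
`Summit.AtomisticToContinuum.HydrodynamicLimit.Theses.JaynesSqueeze.MeanBlocksInRange` — under the conjunct's
hypotheses, `t < T` and the packing guard on `[0,t]`: `∃ m₀ ∀ m ≥ m₀, ∀ᶠ N, ∀ s ∈ [0,t], ∀ cubes B` of side `1/m`,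
the MEAN block fields of the one-body intensity measure `(N+1)⁻¹ Σᵢ law(zᵢ(s))` lie in the compact range
`m³·m_B ∈ [½ inf ρ, 2 sup ρ]`, `θ_B ∈ [½ inf θ, 2 sup θ]`, `|u_B| ≤ 1 + sup |u|` (inf / sup of the classical
solution over `[0,t] × 𝕋³`).

## The line: fixed-time hydrodynamic shadow + asymptotic equicontinuity in time ⟹ uniform range

The crux is UNIFORM in `s ∈ [0,t]` inside `∀ᶠ N` (the refuter's crux attack, ATTACK.md §7a on the item:
"R = conjunct-at-every-s + equicontinuity in s of the block means"). The skeleton makes exactly that cut: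

* `stub_pointwiseBlocksInRange` (conjunct-shadow at FIXED times, open-problem strength but strictly below the
  crux in quantifier strength: `∀ s ∈ [0,t], ∀ᶠ N` instead of `∀ᶠ N, ∀ s`; TIGHTER windows `[¾ inf ρ, 3/2 sup ρ]`,
  `[¾ inf θ, 3/2 sup θ]`, `|u_B| ≤ ½ + sup|u|`). Mechanism foreseen: the hydrodynamic limit AT TIME `s`
  (convergence in probability of the empirical fields tested against continuous `χ`) + uniform integrability of
  the block mass / momentum / kinetic energy (pathwise conservation of the total kinetic energy by the hard-sphere
  flow + Gaussian velocity tails of the local Gibbs data) ⟹ convergence of the MEAN block mass, momentum and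
  energy to the Euler block integrals (cubes approximated from inside/outside by continuous `χ`, `ρ_s` bounded);
  the Euler block averages lie in `[inf ρ, sup ρ]`, `[inf θ, sup θ + osc_B(u)²/3]`, `|·| ≤ sup|u|`, and `m₀`
  absorbs the in-block velocity oscillation (uniform continuity of `u` on `[0,t] × 𝕋³`).
* `stub_blockFieldsEquicontinuous` (HARDEST — the dynamical content that is NOT a fixed-time statement):
  asymptotic uniform equicontinuity in time, uniformly over the finitely many blocks, of the mean block density,
  kinetic temperature and velocity: `∃ m₁ ∀ m ≥ m₁ ∀ ε > 0 ∃ δ > 0, ∀ᶠ N, ∀ s, s' ∈ [0,t], |s − s'| ≤ δ →`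
  the three block fields at `s` and `s'` differ by `≤ ε`. Mass is kinematic (mean displacement per particle over
  `[s,s']` is `≤ |s−s'|·√(2e_N)` pathwise by energy conservation + Cauchy–Schwarz, plus no concentration of the
  intensity measure on the faces `∂B` at net times); momentum / temperature need control of the time-integrated
  COLLISIONAL transfer across `∂B` (an `O(1)` rate = the collisional stress, i.e. a bound on the collision rate
  across a fixed surface at fixed reduced density) or the conjunct in locally-uniform-in-time form.

Composition `MeanBlocksInRange_of` (PROVED below, no sorry, standard axioms): `σ₀ := min`, `ηc := min`,
`m₀ := max m₀ m₁`; positivity of `inf ρ, sup ρ, inf θ, sup θ` over `[0,t] × 𝕋³` from the classical solution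
(`HsEulerCalc.exists_pos_le_of_isSmoothSpaceTimeOn`, `Torus.IsSmoothSpaceTimeOn.exists_norm_le_of_isCompact`);
`ε := min (min (inf ρ/4) (sup ρ/2)) (min (min (inf θ/4) (sup θ/2)) ½)`; a finite `δ`-net of the compact `[0,t]`
(`finite_cover_balls_of_compact`), `Set.Finite.eventually_all` to intersect the finitely many fixed-time
eventualities with the equicontinuity eventuality, and the window arithmetic `¾A − A/4 = A/2`,
`3/2·S + S/2 = 2S`, `½ + U + ½ = 1 + U` (`window_arith`).

BC3 probes (folder `bc/`): for each stub `S`, `S → MeanBlocksInRange` and `S → _root_.HydrodynamicLimit` by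
`first | exact? | simpa | aesop` FAIL (neither stub is cheaply the crux or the summit): stub 1 has the wrong
quantifier order for the crux and profile-dependent `ηc` / a `[0,t]`-guard for the summit; stub 2 carries no
information on the values of the block fields.

Disproof.lean for this crux: none on file (no `_false_without_` obstruction to honour); negatives index: the
only nearby refutation (9168, junk-EOS of an unguarded EOS statement) does not concern block ranges.
-/

namespace Summit.AtomisticToContinuum.HydrodynamicLimit.Cruxes.MeanBlocksInRange.Birth

open MeasureTheory Filter Set
open Literature.MathematicalPhysics.KineticTheory

/-- Stub statement 1 (fixed-time shadow): under the crux's prefix (profiles, `σ < σ₀`, classical hs-Euler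
solution on `[0,T)`, flows, `t = 0` LLN, `t < T`, packing guard `ρ_s σ³ ≤ ηc` on `[0,t]`) — with the crux's own
`let`-bound block quantities — `∃ m₀ ∀ m ≥ m₀ ∀ s ∈ [0,t], ∀ᶠ N, ∀ blocks k`: TIGHT windows
`¾ inf ρ ≤ m³ mass ≤ 3/2 sup ρ`, `¾ inf θ ≤ temp ≤ 3/2 sup θ`, `‖vel‖ ≤ ½ + sup ‖u‖`.
Verbatim the signature of `stub_pointwiseBlocksInRange`. -/
def PointwiseBlocksInRange : Prop :=
  ∀ (a₀ θ₀ : (UnitAddTorus (Fin 3)) → ℝ) (u₀ : (UnitAddTorus (Fin 3)) → (EuclideanSpace ℝ (Fin 3))), Continuous a₀ → Continuous θ₀ → Continuous u₀ → (∀ x, 0 < a₀ x) → (∀ x, 0 < θ₀ x) → ∃ σ₀ : ℝ, 0 < σ₀ ∧ ∃ ηc : ℝ, 0 < ηc ∧ ∀ σ : ℝ, 0 < σ → σ < σ₀ → ∀ (T : ℝ) (ρ θ : ℝ → (UnitAddTorus (Fin 3)) → ℝ) (u : ℝ → (UnitAddTorus (Fin 3)) → (EuclideanSpace ℝ (Fin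 3))), Literature.MathematicalPhysics.KineticTheory.IsHardSphereEulerSolution σ T ρ u θ → ∀ Φ : (N : ℕ) → Literature.Analysis.FluidPDE.HardSphereFlow (Literature.Analysis.FluidPDE.Torus.geometry (Fin 3)) (Literature.MathematicalPhysics.KineticTheory.hsDiameter σ N) (N + 1), Literature.MathematicalPhysics.KineticTheory.TendstoHydroFieldsAt (fun N => Literature.MathematicalPhysics.KineticTheory.localGibbsLaw σ a₀ u₀ θ₀ N (Φ N)) Φ ρ u θ 0 → ∀ t ∈ Set.Ico 0 T, (∀ s ∈ Set.Icc 0 t, ∀ x, ρ s x * σ ^ 3 ≤ ηc) → let P : (N : ℕ) → MeasureTheory.Measure (Literature.Analysis.FluidPDE.Config (N + 1) (Fin 3) (UnitAddTorus (Fin 3))) := fun N => Literature.MathematicalPhysics.KineticTheory.localGibbsLaw σ a₀ u₀ θ₀ N (Φ N); let μ : (N : ℕ) → ℝ → MeasureTheory.Measure ((UnitAddTorus (Fin 3)) × (EuclideanSpace ℝ (Fin 3))) := fun N s => ((N : ENNReal) + 1)⁻¹ • MeasureTheory.Measure.sum (fun i : Fin (N + 1) => ((Φ N).lawAt (P N)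 s).map (fun z => z i)); let idx : ℕ → (UnitAddTorus (Fin 3)) → (Fin 3 → ℕ) := fun m x i => ⌊(m : ℝ) * Literature.Analysis.FunctionSpaces.Torus.repr x i⌋₊; let μB : ℕ → ℝ → ℕ → (Fin 3 → ℕ) → MeasureTheory.Measure (EuclideanSpace ℝ (Fin 3)) := fun N s m k => ((μ N s).restrict ({x : (UnitAddTorus (Fin 3)) | idx m x = k} ×ˢ (Set.univ : Set (EuclideanSpace ℝ (Fin 3))))).snd; let mass : ℕ → ℝ → ℕ → (Fin 3 → ℕ) → ℝ := fun N s m k => ((μB N s m k) Set.univ).toReal; let vel : ℕ → ℝ → ℕ → (Fin 3 → ℕ) → (EuclideanSpace ℝ (Fin 3)) := fun N s m k => (mass N s m k)⁻¹ • ∫ v, v ∂(μB N s m k); let temp : ℕ → ℝ → ℕ → (Fin 3 → ℕ) → ℝ := fun N s m k => (3 * mass N s m k)⁻¹ * ∫ v, ‖v - vel N s m k‖ ^ 2 ∂(μB N s m k); ∃ m₀ : ℕ, ∀ m : ℕ, m₀ ≤ m → ∀ s ∈ Set.Icc 0 t, ∀ᶠ N : ℕ in Filter.atTop, ∀ k ∈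 Fintype.piFinset (fun _ : Fin 3 => Finset.range m), 3 / 4 * (⨅ q : Set.Icc 0 t × (UnitAddTorus (Fin 3)), ρ q.1 q.2) ≤ (m : ℝ) ^ 3 * mass N s m k ∧ (m : ℝ) ^ 3 * mass N s m k ≤ 3 / 2 * (⨆ q : Set.Icc 0 t × (UnitAddTorus (Fin 3)), ρ q.1 q.2) ∧ 3 / 4 * (⨅ q : Set.Icc 0 t × (UnitAddTorus (Fin 3)), θ q.1 q.2) ≤ temp N s m k ∧ temp N s m k ≤ 3 / 2 * (⨆ q : Set.Icc 0 t × (UnitAddTorus (Fin 3)), θ q.1 q.2) ∧ ‖vel N s m k‖ ≤ 1 / 2 + ⨆ q : Set.Icc 0 t × (UnitAddTorus (Fin 3)), ‖u q.1 q.2‖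

/-- Stub statement 2 (asymptotic equicontinuity in time of the mean block fields, uniformly over blocks):
same prefix; `∃ m₁ ∀ m ≥ m₁ ∀ ε > 0 ∃ δ > 0, ∀ᶠ N, ∀ s s' ∈ [0,t], |s − s'| ≤ δ → ∀ blocks k`:
`|m³ mass(s) − m³ mass(s')| ≤ ε`, `|temp(s) − temp(s')| ≤ ε`, `‖vel(s) − vel(s')‖ ≤ ε`.
Verbatim the signature of `stub_blockFieldsEquicontinuous`. -/
def BlockFieldsEquicontinuous : Prop :=
  ∀ (a₀ θ₀ : (UnitAddTorus (Fin 3)) → ℝ) (u₀ : (UnitAddTorus (Fin 3)) → (EuclideanSpace ℝ (Fin 3))), Continuous a₀ → Continuous θ₀ → Continuous u₀ → (∀ x, 0 < a₀ x) → (∀ x, 0 < θ₀ x) → ∃ σ₀ : ℝ, 0 < σ₀ ∧ ∃ ηc : ℝ, 0 < ηc ∧ ∀ σ : ℝ, 0 < σ → σ < σ₀ → ∀ (T : ℝ) (ρ θ : ℝ → (UnitAddTorus (Fin 3)) → ℝ) (u : ℝ → (UnitAddTorus (Fin 3)) → (EuclideanSpace ℝ (Fin 3))), Literature.MathematicalPhysics.KineticTheory.IsHardSphereEulerSolution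 σ T ρ u θ → ∀ Φ : (N : ℕ) → Literature.Analysis.FluidPDE.HardSphereFlow (Literature.Analysis.FluidPDE.Torus.geometry (Fin 3)) (Literature.MathematicalPhysics.KineticTheory.hsDiameter σ N) (N + 1), Literature.MathematicalPhysics.KineticTheory.TendstoHydroFieldsAt (fun N => Literature.MathematicalPhysics.KineticTheory.localGibbsLaw σ a₀ u₀ θ₀ N (Φ N)) Φ ρ u θ 0 → ∀ t ∈ Set.Ico 0 T, (∀ s ∈ Set.Icc 0 t, ∀ x, ρ s x * σ ^ 3 ≤ ηc) → let P : (N : ℕ) → MeasureTheory.Measure (Literature.Analysis.FluidPDE.Config (N + 1) (Fin 3) (UnitAddTorus (Fin 3))) := fun N => Literature.MathematicalPhysics.KineticTheory.localGibbsLaw σ a₀ u₀ θ₀ N (Φ N); let μ : (N : ℕ) → ℝ → MeasureTheory.Measure ((UnitAddTorus (Fin 3)) × (EuclideanSpace ℝ (Fin 3))) := fun N s => ((N : ENNReal) + 1)⁻¹ • MeasureTheory.Measure.sum (fun i : Fin (N + 1) => ((Φ N).lawAt (P N) s).map (fun z => z i)); let idx : ℕ → (UnitAddTorus (Fin 3))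 → (Fin 3 → ℕ) := fun m x i => ⌊(m : ℝ) * Literature.Analysis.FunctionSpaces.Torus.repr x i⌋₊; let μB : ℕ → ℝ → ℕ → (Fin 3 → ℕ) → MeasureTheory.Measure (EuclideanSpace ℝ (Fin 3)) := fun N s m k => ((μ N s).restrict ({x : (UnitAddTorus (Fin 3)) | idx m x = k} ×ˢ (Set.univ : Set (EuclideanSpace ℝ (Fin 3))))).snd; let mass : ℕ → ℝ → ℕ → (Fin 3 → ℕ) → ℝ := fun N s m k => ((μB N s m k) Set.univ).toReal; let vel : ℕ → ℝ → ℕ → (Fin 3 → ℕ) → (EuclideanSpace ℝ (Fin 3)) := fun N s m k => (mass N s m k)⁻¹ • ∫ v, v ∂(μB N s m k); let temp : ℕ → ℝ → ℕ → (Fin 3 → ℕ) → ℝ := fun N s m k => (3 * mass N s m k)⁻¹ * ∫ v, ‖v - vel N s m k‖ ^ 2 ∂(μB N s m k); ∃ m₁ : ℕ, ∀ m : ℕ, m₁ ≤ m → ∀ ε : ℝ, 0 < ε → ∃ δ : ℝ, 0 < δ ∧ ∀ᶠ N : ℕ in Filter.atTop, ∀ s ∈ Set.Icc 0 t, ∀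 s' ∈ Set.Icc 0 t, |s - s'| ≤ δ → ∀ k ∈ Fintype.piFinset (fun _ : Fin 3 => Finset.range m), |(m : ℝ) ^ 3 * mass N s m k - (m : ℝ) ^ 3 * mass N s' m k| ≤ ε ∧ |temp N s m k - temp N s' m k| ≤ ε ∧ ‖vel N s m k - vel N s' m k‖ ≤ ε

/-! The registered stub statements under their stub names (so that the hypotheses of `MeanBlocksInRange_of` — the ONLY
theorem of this file concluding the crux — are the declared stubs by name, as the skeleton audit requires). -/
namespace Registered
/-- = `PointwiseBlocksInRange`, the statement of `stub_pointwiseBlocksInRange`. -/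
abbrev stub_pointwiseBlocksInRange : Prop := PointwiseBlocksInRange
/-- = `BlockFieldsEquicontinuous`, the statement of `stub_blockFieldsEquicontinuous`. -/
abbrev stub_blockFieldsEquicontinuous : Prop := BlockFieldsEquicontinuous
end Registered

/-! ### Registered stubs -/

/-- STUB 1 (fixed-time hydrodynamic shadow of the mean block profile; open-problem strength, below the crux). -/
theorem stub_pointwiseBlocksInRange : ∀ (a₀ θ₀ : (UnitAddTorus (Fin 3)) → ℝ) (u₀ : (UnitAddTorus (Fin 3)) → (EuclideanSpace ℝ (Fin 3))), Continuous a₀ → Continuous θ₀ → Continuous u₀ → (∀ x, 0 < a₀ x) → (∀ x, 0 < θ₀ x) → ∃ σ₀ : ℝ, 0 < σ₀ ∧ ∃ ηc : ℝ, 0 < ηc ∧ ∀ σ : ℝ, 0 < σ → σ < σ₀ → ∀ (T : ℝ) (ρ θ : ℝ → (UnitAddTorus (Fin 3)) → ℝ) (u : ℝ → (UnitAddTorus (Fin 3)) → (EuclideanSpace ℝ (Fin 3))), Literature.MathematicalPhysics.KineticTheory.IsHardSphereEulerSolution σ T ρ u θ → ∀ Φ : (N : ℕ) → Literature.Analysis.FluidPDE.HardSphereFlow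 (Literature.Analysis.FluidPDE.Torus.geometry (Fin 3)) (Literature.MathematicalPhysics.KineticTheory.hsDiameter σ N) (N + 1), Literature.MathematicalPhysics.KineticTheory.TendstoHydroFieldsAt (fun N => Literature.MathematicalPhysics.KineticTheory.localGibbsLaw σ a₀ u₀ θ₀ N (Φ N)) Φ ρ u θ 0 → ∀ t ∈ Set.Ico 0 T, (∀ s ∈ Set.Icc 0 t, ∀ x, ρ s x * σ ^ 3 ≤ ηc) → let P : (N : ℕ) → MeasureTheory.Measure (Literature.Analysis.FluidPDE.Config (N + 1) (Fin 3) (UnitAddTorus (Fin 3))) := fun N => Literature.MathematicalPhysics.KineticTheory.localGibbsLaw σ a₀ u₀ θ₀ N (Φ N); let μ : (N : ℕ) → ℝ → MeasureTheory.Measure ((UnitAddTorus (Fin 3)) × (EuclideanSpace ℝ (Fin 3))) := fun N s => ((N : ENNReal) + 1)⁻¹ • MeasureTheory.Measure.sum (fun i : Fin (N + 1) => ((Φ N).lawAt (P N) s).map (fun z => z i)); let idx : ℕ → (UnitAddTorus (Fin 3)) → (Fin 3 → ℕ) := fun m x i => ⌊(m : ℝ) * Literature.Analysis.FunctionSpaces.Torus.repr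 x i⌋₊; let μB : ℕ → ℝ → ℕ → (Fin 3 → ℕ) → MeasureTheory.Measure (EuclideanSpace ℝ (Fin 3)) := fun N s m k => ((μ N s).restrict ({x : (UnitAddTorus (Fin 3)) | idx m x = k} ×ˢ (Set.univ : Set (EuclideanSpace ℝ (Fin 3))))).snd; let mass : ℕ → ℝ → ℕ → (Fin 3 → ℕ) → ℝ := fun N s m k => ((μB N s m k) Set.univ).toReal; let vel : ℕ → ℝ → ℕ → (Fin 3 → ℕ) → (EuclideanSpace ℝ (Fin 3)) := fun N s m k => (mass N s m k)⁻¹ • ∫ v, v ∂(μB N s m k); let temp : ℕ → ℝ → ℕ → (Fin 3 → ℕ) → ℝ := fun N s m k => (3 * mass N s m k)⁻¹ * ∫ v, ‖v - vel N s m k‖ ^ 2 ∂(μB N s m k); ∃ m₀ : ℕ, ∀ m : ℕ, m₀ ≤ m → ∀ s ∈ Set.Icc 0 t, ∀ᶠ N : ℕ in Filter.atTop, ∀ k ∈ Fintype.piFinset (fun _ : Fin 3 => Finset.range m), 3 / 4 * (⨅ q : Set.Icc 0 t × (UnitAddTorus (Fin 3)), ρ q.1 q.2) ≤ (m : ℝ)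 ^ 3 * mass N s m k ∧ (m : ℝ) ^ 3 * mass N s m k ≤ 3 / 2 * (⨆ q : Set.Icc 0 t × (UnitAddTorus (Fin 3)), ρ q.1 q.2) ∧ 3 / 4 * (⨅ q : Set.Icc 0 t × (UnitAddTorus (Fin 3)), θ q.1 q.2) ≤ temp N s m k ∧ temp N s m k ≤ 3 / 2 * (⨆ q : Set.Icc 0 t × (UnitAddTorus (Fin 3)), θ q.1 q.2) ∧ ‖vel N s m k‖ ≤ 1 / 2 + ⨆ q : Set.Icc 0 t × (UnitAddTorus (Fin 3)), ‖u q.1 q.2‖ := by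
  sorry

/-- STUB 2 (HARDEST: asymptotic equicontinuity in time of the mean block fields, uniformly in `N`). -/
theorem stub_blockFieldsEquicontinuous : ∀ (a₀ θ₀ : (UnitAddTorus (Fin 3)) → ℝ) (u₀ : (UnitAddTorus (Fin 3)) → (EuclideanSpace ℝ (Fin 3))), Continuous a₀ → Continuous θ₀ → Continuous u₀ → (∀ x, 0 < a₀ x) → (∀ x, 0 < θ₀ x) → ∃ σ₀ : ℝ, 0 < σ₀ ∧ ∃ ηc : ℝ, 0 < ηc ∧ ∀ σ : ℝ, 0 < σ → σ < σ₀ → ∀ (T : ℝ) (ρ θ : ℝ → (UnitAddTorus (Fin 3)) → ℝ) (u : ℝ → (UnitAddTorus (Fin 3)) → (EuclideanSpace ℝ (Fin 3))), Literature.MathematicalPhysics.KineticTheory.IsHardSphereEulerSolution σ T ρ u θ → ∀ Φ : (N : ℕ) → Literature.Analysis.FluidPDE.HardSphereFlow (Literature.Analysis.FluidPDE.Torus.geometry (Fin 3)) (Literature.MathematicalPhysics.KineticTheory.hsDiameter σ N) (N + 1), Literature.MathematicalPhysics.KineticTheory.TendstoHydroFieldsAt (fun N => Literature.MathematicalPhysics.KineticTheory.localGibbsLaw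 σ a₀ u₀ θ₀ N (Φ N)) Φ ρ u θ 0 → ∀ t ∈ Set.Ico 0 T, (∀ s ∈ Set.Icc 0 t, ∀ x, ρ s x * σ ^ 3 ≤ ηc) → let P : (N : ℕ) → MeasureTheory.Measure (Literature.Analysis.FluidPDE.Config (N + 1) (Fin 3) (UnitAddTorus (Fin 3))) := fun N => Literature.MathematicalPhysics.KineticTheory.localGibbsLaw σ a₀ u₀ θ₀ N (Φ N); let μ : (N : ℕ) → ℝ → MeasureTheory.Measure ((UnitAddTorus (Fin 3)) × (EuclideanSpace ℝ (Fin 3))) := fun N s => ((N : ENNReal) + 1)⁻¹ • MeasureTheory.Measure.sum (fun i : Fin (N + 1) => ((Φ N).lawAt (P N) s).map (fun z => z i)); let idx : ℕ → (UnitAddTorus (Fin 3)) → (Fin 3 → ℕ) := fun m x i => ⌊(m : ℝ) * Literature.Analysis.FunctionSpaces.Torus.repr x i⌋₊; let μB : ℕ → ℝ → ℕ → (Fin 3 → ℕ) → MeasureTheory.Measure (EuclideanSpace ℝ (Fin 3)) := fun N s m k => ((μ N s).restrict ({x : (UnitAddTorus (Fin 3)) | idx m x = k} ×ˢ (Set.univ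 : Set (EuclideanSpace ℝ (Fin 3))))).snd; let mass : ℕ → ℝ → ℕ → (Fin 3 → ℕ) → ℝ := fun N s m k => ((μB N s m k) Set.univ).toReal; let vel : ℕ → ℝ → ℕ → (Fin 3 → ℕ) → (EuclideanSpace ℝ (Fin 3)) := fun N s m k => (mass N s m k)⁻¹ • ∫ v, v ∂(μB N s m k); let temp : ℕ → ℝ → ℕ → (Fin 3 → ℕ) → ℝ := fun N s m k => (3 * mass N s m k)⁻¹ * ∫ v, ‖v - vel N s m k‖ ^ 2 ∂(μB N s m k); ∃ m₁ : ℕ, ∀ m : ℕ, m₁ ≤ m → ∀ ε : ℝ, 0 < ε → ∃ δ : ℝ, 0 < δ ∧ ∀ᶠ N : ℕ in Filter.atTop, ∀ s ∈ Set.Icc 0 t, ∀ s' ∈ Set.Icc 0 t, |s - s'| ≤ δ → ∀ k ∈ Fintype.piFinset (fun _ : Fin 3 => Finset.range m), |(m : ℝ) ^ 3 * mass N s m k - (m : ℝ) ^ 3 * mass N s' m k| ≤ ε ∧ |temp N s m k - temp N s' m k| ≤ ε ∧ ‖vel N s m k - vel N s' m k‖ ≤ ε := by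
  sorry

/-! ### Proved glue -/

/-- A positive jointly smooth field has positive infimum over the compact slab `[0,t] × 𝕋³`, `t < T`. -/
theorem iInf_slab_pos {T t : ℝ} {f : ℝ → T3 → ℝ}
    (hf : Literature.Analysis.FunctionSpaces.Torus.IsSmoothSpaceTimeOn (Set.Ico 0 T) f)
    (hpos : ∀ s ∈ Set.Ico 0 T, ∀ x, 0 < f s x) (ht : t ∈ Set.Ico 0 T) :
    0 < ⨅ q : Set.Icc 0 t × (UnitAddTorus (Fin 3)), f q.1 q.2 := by
  obtain ⟨c, hc, hcf⟩ := HsEulerCalc.exists_pos_le_of_isSmoothSpaceTimeOn hf hpos ht.2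
  haveI : Nonempty (Set.Icc 0 t × (UnitAddTorus (Fin 3))) := ⟨(⟨0, le_rfl, ht.1⟩, 0)⟩
  exact lt_of_lt_of_le hc (le_ciInf fun q => hcf q.1 q.1.2 q.2)

/-- A positive jointly smooth field has positive (conditionally complete) supremum over `[0,t] × 𝕋³`, `t < T`. -/
theorem iSup_slab_pos {T t : ℝ} {f : ℝ → T3 → ℝ}
    (hf : Literature.Analysis.FunctionSpaces.Torus.IsSmoothSpaceTimeOn (Set.Ico 0 T) f)
    (hpos : ∀ s ∈ Set.Ico 0 T, ∀ x, 0 < f s x) (ht : t ∈ Set.Ico 0 T) :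
    0 < ⨆ q : Set.Icc 0 t × (UnitAddTorus (Fin 3)), f q.1 q.2 := by
  obtain ⟨C, hC⟩ := hf.exists_norm_le_of_isCompact isCompact_Icc (Set.Icc_subset_Ico_right ht.2)
  have hb : BddAbove (Set.range fun q : Set.Icc 0 t × (UnitAddTorus (Fin 3)) => f q.1 q.2) := by
    refine ⟨C, ?_⟩
    rintro _ ⟨q, rfl⟩
    have h := hC q.1 q.1.2 q.2
    rw [Real.norm_eq_abs] at h
    exact (le_abs_self _).trans h
  have h0 : (0 : ℝ) ∈ Set.Ico 0 T := ⟨le_rfl, ht.1.trans_lt ht.2⟩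
  exact lt_of_lt_of_le (hpos 0 h0 0)
    (le_ciSup hb ((⟨0, le_rfl, ht.1⟩ : Set.Icc (0 : ℝ) t), (0 : UnitAddTorus (Fin 3))))

/-- Window arithmetic: tight windows at a net time `s'` plus `ε`-closeness of the block fields at `s` and `s'`,
`ε := min (min (A/4) (S/2)) (min (min (Θi/4) (Θs/2)) ½)`, give the crux's windows at `s`. -/
theorem window_arith {A S Θi Θs U a a' b b' : ℝ} {c c' : EuclideanSpace ℝ (Fin 3)}
    (hP : 3 / 4 * A ≤ a' ∧ a' ≤ 3 / 2 * S ∧ 3 / 4 * Θi ≤ b' ∧ b' ≤ 3 / 2 * Θs ∧ ‖c'‖ ≤ 1 / 2 + U)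
    (hE : |a - a'| ≤ min (min (A / 4) (S / 2)) (min (min (Θi / 4) (Θs / 2)) (1 / 2)) ∧
      |b - b'| ≤ min (min (A / 4) (S / 2)) (min (min (Θi / 4) (Θs / 2)) (1 / 2)) ∧
      ‖c - c'‖ ≤ min (min (A / 4) (S / 2)) (min (min (Θi / 4) (Θs / 2)) (1 / 2))) :
    A / 2 ≤ a ∧ a ≤ 2 * S ∧ Θi / 2 ≤ b ∧ b ≤ 2 * Θs ∧ ‖c‖ ≤ 1 + U := by
  obtain ⟨h1, h2, h3, h4, h5⟩ := hP
  obtain ⟨e1, e2, e3⟩ := hE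
  set ε := min (min (A / 4) (S / 2)) (min (min (Θi / 4) (Θs / 2)) (1 / 2)) with hε
  have hεA : ε ≤ A / 4 := (min_le_left _ _).trans (min_le_left _ _)
  have hεS : ε ≤ S / 2 := (min_le_left _ _).trans (min_le_right _ _)
  have hεΘi : ε ≤ Θi / 4 := (min_le_right _ _).trans ((min_le_left _ _).trans (min_le_left _ _))
  have hεΘs : ε ≤ Θs / 2 := (min_le_right _ _).trans ((min_le_left _ _).trans (min_le_right _ _))
  have hεh : ε ≤ 1 / 2 := (min_le_right _ _).trans (min_le_right _ _)
  rw [abs_le] at e1 e2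
  refine ⟨by linarith [e1.1, e1.2], by linarith [e1.1, e1.2], by linarith [e2.1, e2.2],
    by linarith [e2.1, e2.2], ?_⟩
  calc ‖c‖ = ‖(c - c') + c'‖ := by rw [sub_add_cancel]
    _ ≤ ‖c - c'‖ + ‖c'‖ := norm_add_le _ _
    _ ≤ 1 + U := by linarith

/-! ### The composition: the two stubs imply the crux BY NAME -/

/-- **The skeleton theorem** `stub_pointwiseBlocksInRange → stub_blockFieldsEquicontinuous → MeanBlocksInRange` (crux BY
NAME; no `sorry` of its own): `σ₀, ηc := min`, `m₀ := max`, positivity of the range parameters, a finite `δ`-net of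
`[0,t]`, finite intersection of eventualities, window arithmetic. -/
theorem MeanBlocksInRange_of (h1 : Registered.stub_pointwiseBlocksInRange)
    (h2 : Registered.stub_blockFieldsEquicontinuous) :
    Summit.AtomisticToContinuum.HydrodynamicLimit.Theses.JaynesSqueeze.MeanBlocksInRange := by
  intro a₀ θ₀ u₀ ha hθ hu hap hθp
  obtain ⟨σ₁, hσ₁, η₁, hη₁, H1⟩ := h1 a₀ θ₀ u₀ ha hθ hu hap hθp
  obtain ⟨σ₂, hσ₂, η₂, hη₂, H2⟩ := h2 a₀ θ₀ u₀ ha hθ hu hap hθp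
  refine ⟨min σ₁ σ₂, lt_min hσ₁ hσ₂, min η₁ η₂, lt_min hη₁ hη₂, ?_⟩
  intro σ hσ hσlt T ρ θ u hE Φ h0 t ht hguard
  have hg1 : ∀ s ∈ Set.Icc 0 t, ∀ x, ρ s x * σ ^ 3 ≤ η₁ :=
    fun s hs x => (hguard s hs x).trans (min_le_left _ _)
  have hg2 : ∀ s ∈ Set.Icc 0 t, ∀ x, ρ s x * σ ^ 3 ≤ η₂ :=
    fun s hs x => (hguard s hs x).trans (min_le_right _ _)
  have K1 := H1 σ hσ (lt_of_lt_of_le hσlt (min_le_left _ _)) T ρ θ u hE Φ h0 t ht hg1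
  have K2 := H2 σ hσ (lt_of_lt_of_le hσlt (min_le_right _ _)) T ρ θ u hE Φ h0 t ht hg2
  dsimp only at K1 K2 ⊢
  obtain ⟨m₀, hm₀⟩ := K1
  obtain ⟨m₁, hm₁⟩ := K2
  -- positivity of the four range parameters of the classical solution on `[0,t] × 𝕋³`
  have hA := iInf_slab_pos hE.smooth_density hE.density_pos ht
  have hS := iSup_slab_pos hE.smooth_density hE.density_pos ht
  have hΘi := iInf_slab_pos hE.smooth_temperature hE.temperature_pos ht
  have hΘs := iSup_slab_pos hE.smooth_temperature hE.temperature_pos ht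
  have hεpos := lt_min (lt_min (div_pos hA four_pos) (half_pos hS))
    (lt_min (lt_min (div_pos hΘi four_pos) (half_pos hΘs)) (one_half_pos (α := ℝ)))
  refine ⟨max m₀ m₁, fun m hm => ?_⟩
  have hPt := hm₀ m (le_of_max_le_left hm)
  obtain ⟨δ, hδ, hEq⟩ := hm₁ m (le_of_max_le_right hm) _ hεpos
  -- a finite `δ`-net of the compact time interval
  obtain ⟨F, hFsub, hFfin, hcover⟩ :=
    finite_cover_balls_of_compact (isCompact_Icc : IsCompact (Set.Icc (0 : ℝ) t)) hδ
  have hF := hFfin.eventually_all.2 fun s' hs' => hPt s' (hFsub hs')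
  filter_upwards [hF, hEq] with N hN hN' s hs k hk
  obtain ⟨s', hs'F, hss'⟩ := Set.mem_iUnion₂.1 (hcover hs)
  have hd : |s - s'| ≤ δ := by
    rw [← Real.dist_eq]
    exact (Metric.mem_ball.1 hss').le
  exact window_arith (hN s' hs'F k hk) (hN' s hs s' (hFsub hs'F) hd k hk)

/-- Wiring check: the registered stubs feed `MeanBlocksInRange_of` exactly as stated. -/
example : Summit.AtomisticToContinuum.HydrodynamicLimit.Theses.JaynesSqueeze.MeanBlocksInRange :=
  MeanBlocksInRange_of stub_pointwiseBlocksInRange stub_blockFieldsEquicontinuous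

end Summit.AtomisticToContinuum.HydrodynamicLimit.Cruxes.MeanBlocksInRange.Birth
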